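import Summits.QuantumFields.QCD.Theorems.QuarksAsStableActionStableActionBridgeSliceKernelGlue

/-!
# Gauge invariance of the Wilson pure-gauge transfer kernel under simultaneous transformations
(crux `QuarksAsStableAction.StableActionBridge`, item stmt-QuantumFields-9737, line `Sketch`; lead theorem of
continuation lead c6, cycle 7, `--supports stmt-QuantumFields-9737`; registered sub-goal `gaugeSliceKernel_gaugeTransform`)

For a time-independent gauge transformation `g : sites → SU(3)` applied to BOTH slices the temporal-gauge transfer
kernel of `Literature/…/QCDTransferMatrix.lean` is invariant: `K_β(U^g, U'^g) = K_β(U, U')` (Smit §4.6 (4.124)–(4.126):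
`T̂_U` commutes with the Gauss-law projector).  Proof: write both sides through the glue identity
`K_β(U, U'^g) = e^{−βS₃(U)/2} e^{−βS_tm(U,g,U')} e^{−βS₃(U')/2}` (`gaugeSliceKernel_gaugeTransform_right`, p127530), the
gauge invariance of the spatial Wilson action (`wilsonAction_gaugeTransform`) and the elementary identity
`S_tm(U^g, g, U') = S_tm(U, 1, U')` (the temporal plaquette `g_x U'_l g_y⁻¹ (g_x U_l g_y⁻¹)⁻¹ = g_x (U'_l U_l⁻¹) g_x⁻¹`
has the same trace).

[cite: Smit2023, §4.6 (4.124)–(4.129)] [cite: OsterwalderSeiler1978, §2]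
-/

noncomputable section

open MeasureTheory Matrix Literature.MathematicalPhysics.QuantumFieldTheory
  Literature.MathematicalPhysics.QuantumLattice
open Literature.Probability.LatticeModels (TorusSite)

namespace Summit.QuantumFields.QCD.Cruxes.StableActionBridge.Sketch

namespace SliceKernelInvariance

/-- The trivial gauge transformation does nothing. [folklore] -/
theorem gaugeTransform_one {d L : ℕ} {G : Type*} [Group G] (U : GaugeConfig d L G) :
    gaugeTransform (1 : Literature.MathematicalPhysics.QuantumFieldTheory.Site d L → G) U = U := by
  funext e
  simp [gaugeTransform]

/-- Temporal plaquette energies: transforming the first slice by `g` and using `g` as temporal links is the same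
as trivial temporal links, `S_tm(U^g, g, U') = S_tm(U, 1, U')` (conjugation by `g_x` inside the trace). [folklore] -/
theorem sliceTemporalAction_gaugeTransform_left {N n : ℕ} [NeZero N] {G : Type*} [Group G]
    (ρ : G →* Matrix (Fin n) (Fin n) ℂ) (U U' : GaugeConfig 3 N G)
    (g : Literature.MathematicalPhysics.QuantumFieldTheory.Site 3 N → G) :
    sliceTemporalAction ρ (gaugeTransform g U) g U' = sliceTemporalAction ρ U 1 U' := by
  unfold sliceTemporalAction
  refine Finset.sum_congr rfl fun x _ => Finset.sum_congr rfl fun i _ => ?_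
  have hconj : g x * U' (x, i) * (g (x.shift i))⁻¹ * (gaugeTransform g U (x, i))⁻¹ =
      g x * (U' (x, i) * (U (x, i))⁻¹) * (g x)⁻¹ := by
    simp only [gaugeTransform, _root_.mul_inv_rev, inv_inv]
    group
  have htr : (ρ (g x * (U' (x, i) * (U (x, i))⁻¹) * (g x)⁻¹)).trace =
      (ρ (U' (x, i) * (U (x, i))⁻¹)).trace := by
    rw [map_mul, map_mul, Matrix.trace_mul_cycle, ← map_mul, inv_mul_cancel, map_one, one_mul]
  rw [hconj, htr]
  simp

end SliceKernelInvariance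

open SliceKernelInvariance

/-- **Gauge invariance of the transfer kernel** (registered sub-goal `gaugeSliceKernel_gaugeTransform`): for every
time-independent gauge transformation `g` and all slice configurations `U, U'`,
`gaugeSliceKernel β (U^g) (U'^g) = gaugeSliceKernel β U U'` — the kernel-level statement that Wilson's pure-gauge
transfer operator commutes with gauge transformations (hence with the Gauss-law projector `P̂₀`).
[cite: Smit2023, §4.6 (4.124)–(4.129)] -/
theorem gaugeSliceKernel_gaugeTransform : ∀ (S : ℕ) [NeZero S] (β : ℝ) (g : TorusSite 3 S → Matrix.specialUnitaryGroup (Fin 3) ℂ) (U U' : GaugeConfig 3 S (Matrix.specialUnitaryGroup (Fin 3) ℂ)), gaugeSliceKernel β (gaugeTransform g U) (gaugeTransform g U') = gaugeSliceKernel β U U' := by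
  intro S _ β g U U'
  conv_rhs => rw [← gaugeTransform_one U']
  rw [gaugeSliceKernel_gaugeTransform_right, gaugeSliceKernel_gaugeTransform_right, wilsonAction_gaugeTransform,
    sliceTemporalAction_gaugeTransform_left]

end Summit.QuantumFields.QCD.Cruxes.StableActionBridge.Sketch

end
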